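import Mathlib
import Summits.QuantumFields.BalabanUV.Beta.FP.PeriodicTransportSum

/-!
# Road «FP» (binder row D1), REP∞ — ALG-2, THE PERIODIC TRANSPORT IDENTITY (assembly)

`HOME/b2b-balaban-beta-d1-p3/REP-DESIGN.md` v1.1, kernel-checked.  For a transport column `h : ℤ^d → ℝ` reproducing constants (`σ`) and
linear data (`C`) through the window `N•ℤ^d` with absolutely summable second moments, and a fine kernel `B : ℤ^d → ℤ^d → ℝ` that is
only JOINTLY `N`-periodic with (T0) at BOTH vertices, the `N•ℤ^d`-decimated second moment of the dressed kernel
`𝒦 y := Σ'_{(u,x)} h u · B u (x + y) · h x` is `σ²` times the base-point SUM of the fine second moments of `B` about the base points: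

  **`periodicTransport_hasSum`**: `Σ_z (N z)_κ (N z)_λ · 𝒦 (N•z) = σ² · Σ_r Σ'_v B (resSite r) v · (v − resSite r)_κ (v − resSite r)_λ`.

With the bond normalisation `σ = N^{−(d+1)}` and the `N^{2d}` of `DressedMomentNormalisation.coarseTensor` this is the base-point AVERAGE
(`d = 4`: `N⁸·N⁻¹⁰·N⁻²… = N⁻⁴ = 1/#residues`) — the `_avg` END of the cell (RULING (R13-3)) is forced.  Only (T0) is used: the
`Q(a)`/`C C` terms die by (T0) at the second vertex, the `Q(v)` term by the periodicity of the coset second moments and (T0) at the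
first vertex (§5), and the first-moment cross terms cancel identically (`PeriodicTransport.left_collapse_value`).
* §5 step (H): `exists_bound_of_periodic`, `summable_mul_of_bounded`, **`sum_residue_tsum_mul_periodic_eq_zero`**;
* §6 steps (E)–(G): `Pfun`, **`residue_class_pair_tsum`**, **`pair_tsum_eq`**;
* §7 `dressedK`, `Wgt`, `tsum_Wgt_mul_eq_Pfun` ((E1) in `tsum` form) and **`periodicTransport_hasSum`** (triple family → fibre sums
  (`HasSum.prod_fiberwise`) → decimation reindexing `DecimatedMomentLimit.hasSum_decimate_iff`).
Generalises an4's convolution-kernel `DressedMomentNormalisation.bondSecondMoment_hasSum` (`B u x = T (u − x)`).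
[folklore] throughout; `d` arbitrary; nothing about Bałaban's objects is asserted.
HONEST FRAMING: bookkeeping toward `hident` (GAPS O-asym1-7); discharges nothing of `BetaPertH`; NOT the continuum limit, NOT Clay.
-/

noncomputable section

open Filter Topology
open scoped BigOperators

namespace Summit.QuantumFields.BalabanUV.Beta.FP.PeriodicTransportMain

open Literature.MathematicalPhysics.QuantumFieldTheory.Balaban1983to89
open Literature.MathematicalPhysics.QuantumFieldTheory.Balaban1983to89.Beta
open Literature.MathematicalPhysics.QuantumFieldTheory.Balaban1983to89.Beta.DecimatedMoment (cosetInd)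
open Literature.MathematicalPhysics.QuantumFieldTheory.Balaban1983to89.Beta.DecimatedMomentLimit (abs_cosetInd_le_one cosetInd_zsmul)
open Literature.MathematicalPhysics.QuantumFieldTheory.Balaban1983to89.Beta.DecimatedMomentSummable
  (ConstReproSum LinReproSum AbsMoment₂ IsMoment₂)
open Literature.MathematicalPhysics.QuantumFieldTheory.Balaban1983to89.Beta.DressedMomentNormalisation
  (resSite resOf resSite_resOf cosetInd_resSite_sub)
open Summit.QuantumFields.BalabanUV.Beta.FP.PeriodicTransport
open Summit.QuantumFields.BalabanUV.Beta.FP.PeriodicTransportSum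

variable {d N : ℕ}

/-! ## §5 Step (H): a periodic weight against a kernel with vanishing first-vertex sums -/

section StepH

variable {B : (Fin d → ℤ) → (Fin d → ℤ) → ℝ}

/-- [folklore] An `N`-periodic function takes only the values at the residue sites, hence is bounded. -/
theorem exists_bound_of_periodic (hN : 0 < N) {Q : (Fin d → ℤ) → ℝ} (hQ : ∀ v t, Q (v + (N : ℤ) • t) = Q v) :
    ∃ M : ℝ, ∀ v, |Q v| ≤ M := by
  classical
  haveI : NeZero N := ⟨hN.ne'⟩
  refine ⟨Finset.univ.sup' Finset.univ_nonempty (fun r : Fin d → Fin N => |Q (resSite r)|), fun v => ?_⟩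
  have hv : Q v = Q (resSite (resOf hN v)) := by
    conv_lhs => rw [← resSite_add_zsmul_quotOf hN v]
    exact hQ _ _
  rw [hv]
  exact Finset.le_sup' (fun r : Fin d → Fin N => |Q (resSite r)|) (Finset.mem_univ _)

/-- [folklore] A summable real family times a bounded weight is summable. -/
theorem summable_mul_of_bounded {f Q : (Fin d → ℤ) → ℝ} (hf : Summable f) {M : ℝ} (hQ : ∀ v, |Q v| ≤ M) :
    Summable fun v => f v * Q v := by
  refine Summable.of_norm_bounded (hf.abs.mul_right M) fun v => ?_
  rw [Real.norm_eq_abs, abs_mul]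
  exact mul_le_mul_of_nonneg_left (hQ v) (abs_nonneg _)

/-- [folklore] **Step (H).**  For a jointly `N`-periodic kernel `B` whose FIRST-vertex sums vanish (`Σ'_a B a x = 0` for every `x`)
and an `N`-periodic weight `Q`: `Σ_r Σ'_v B (resSite r) v · Q v = 0`. -/
theorem sum_residue_tsum_mul_periodic_eq_zero (hN : 0 < N) (hper : ∀ u x t, B (u + (N : ℤ) • t) (x + (N : ℤ) • t) = B u x)
    (hT0b : ∀ x, HasSum (fun a => B a x) 0) (hBa : ∀ a, Summable fun v => B a v)
    {Q : (Fin d → ℤ) → ℝ} (hQ : ∀ v t, Q (v + (N : ℤ) • t) = Q v) :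
    ∑ r : Fin d → Fin N, ∑' v, B (resSite r) v * Q v = 0 := by
  obtain ⟨M, hM⟩ := exists_bound_of_periodic hN hQ
  -- split each `v`-series into residue classes of `v`
  have e1 : ∀ r : Fin d → Fin N, ∑' v, B (resSite r) v * Q v
      = ∑ r' : Fin d → Fin N, Q (resSite r') * ∑' s : Fin d → ℤ, B (resSite r) (resSite r' + (N : ℤ) • s) := by
    intro r
    rw [tsum_eq_sum_residue hN (summable_mul_of_bounded (hBa _) hM)]
    refine Finset.sum_congr rfl fun r' _ => ?_
    rw [← tsum_mul_left]
    exact tsum_congr fun s => by rw [hQ]; ring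
  simp_rw [e1]
  rw [Finset.sum_comm]
  refine Finset.sum_eq_zero fun r' _ => ?_
  -- `Σ_r Σ'_s B (resSite r) (resSite r' + N•s) = Σ'_a B a (resSite r') = 0`
  have e2 : ∀ r : Fin d → Fin N, ∑' s : Fin d → ℤ, B (resSite r) (resSite r' + (N : ℤ) • s)
      = ∑' s : Fin d → ℤ, B (resSite r + (N : ℤ) • s) (resSite r') := by
    intro r
    rw [← (Equiv.neg (Fin d → ℤ)).tsum_eq]
    refine tsum_congr fun s => ?_
    simp only [Equiv.neg_apply, smul_neg]
    have := hper (resSite r + (N : ℤ) • s) (resSite r') (-s)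
    rw [smul_neg, show resSite r + (N : ℤ) • s + -((N : ℤ) • s) = resSite r by abel] at this
    exact this
  simp_rw [e2]
  rw [← Finset.mul_sum, ← tsum_eq_sum_residue hN (hT0b (resSite r')).summable, (hT0b (resSite r')).tsum_eq, mul_zero]

end StepH

/-! ## §6 Steps (E)–(G): the pair series `Σ'_{(u,u′)} h u · B u u′ · P u′` through the residue classes of the first vertex -/

section Pair

variable {h : (Fin d → ℤ) → ℝ} {B : (Fin d → ℤ) → (Fin d → ℤ) → ℝ} {σ : ℝ} {C : Fin d → ℝ}

/-- [our object] The right-collapsed weight `P y := σ·y_κ y_λ − y_κ·C_λ − C_κ·y_λ + Q y κ l` ((E1)'s value as a function of `y`). -/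
def Pfun (N : ℕ) (h : (Fin d → ℤ) → ℝ) (σ : ℝ) (C : Fin d → ℝ) (κ l : Fin d) (y : Fin d → ℤ) : ℝ :=
  σ * ((y κ : ℝ) * (y l : ℝ)) - (y κ : ℝ) * C l - C κ * (y l : ℝ) + cosetSecond N h y κ l

/-- [folklore] **One residue class of the first vertex** (steps (E)–(F)–(G) for fixed `r`): with `a := resSite r`,
`Σ'_t Σ'_{u′} h (a + N•t) · B (a + N•t) u′ · P u′ = Σ'_v B a v · (σ²Δ_κΔ_λ + σ·Q a + σ·Q v − 2·C_κC_λ)`, `Δ := v − a`. -/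
theorem residue_class_pair_tsum (hN : 0 < N) (h0 : ConstReproSum N h σ) (h1 : LinReproSum N h C) (hh : AbsMoment₂ h)
    (hper : ∀ u x t, B (u + (N : ℤ) • t) (x + (N : ℤ) • t) = B u x) (κ l : Fin d) (r : Fin d → Fin N)
    (hS : Summable fun p : (Fin d → ℤ) × (Fin d → ℤ) =>
      h (resSite r + (N : ℤ) • p.1) * B (resSite r + (N : ℤ) • p.1) (p.2 + (N : ℤ) • p.1) * Pfun N h σ C κ l (p.2 + (N : ℤ) • p.1)) :
    ∑' t : Fin d → ℤ, ∑' u' : Fin d → ℤ, h (resSite r + (N : ℤ) • t) * B (resSite r + (N : ℤ) • t) u' * Pfun N h σ C κ l u'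
      = ∑' v : Fin d → ℤ, B (resSite r) v *
          (σ ^ 2 * ((((v - resSite r) κ : ℤ) : ℝ) * (((v - resSite r) l : ℤ) : ℝ)) + σ * cosetSecond N h (resSite r) κ l
            + σ * cosetSecond N h v κ l - 2 * (C κ * C l)) := by
  set a : Fin d → ℤ := resSite r with ha
  -- (E) shift the second vertex along with the first: `u′ = v + N•t`, and use periodicity
  have e1 : ∀ t : Fin d → ℤ, ∑' u', h (a + (N : ℤ) • t) * B (a + (N : ℤ) • t) u' * Pfun N h σ C κ l u'
      = ∑' v, h (a + (N : ℤ) • t) * B a v * Pfun N h σ C κ l (v + (N : ℤ) • t) := by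
    intro t
    rw [← (Equiv.addRight ((N : ℤ) • t)).tsum_eq]
    exact tsum_congr fun v => by simp only [Equiv.coe_addRight, hper]
  simp_rw [e1]
  -- (F) interchange `t ↔ v` (the shifted family is summable: hypothesis `hS`, rewritten by periodicity)
  have hS' : Summable fun p : (Fin d → ℤ) × (Fin d → ℤ) =>
      h (a + (N : ℤ) • p.1) * B a p.2 * Pfun N h σ C κ l (p.2 + (N : ℤ) • p.1) := by
    refine hS.congr fun p => ?_
    rw [hper]
  rw [← hS'.tsum_comm', ]
  · -- now `Σ'_v Σ'_t …`; factor `B a v` and collapse the `t`-series by (E2)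
    refine tsum_congr fun v => ?_
    set g : (Fin d → ℤ) → ℝ := fun u => h u * (σ * (((v - a + u) κ : ℤ) : ℝ) * (((v - a + u) l : ℤ) : ℝ)
        - (((v - a + u) κ : ℤ) : ℝ) * C l - C κ * (((v - a + u) l : ℤ) : ℝ) + cosetSecond N h v κ l) with hg
    have e2 : (fun t : Fin d → ℤ => h (a + (N : ℤ) • t) * B a v * Pfun N h σ C κ l (v + (N : ℤ) • t))
        = fun t => B a v * g (a + (N : ℤ) • t) := by
      funext t
      have hv : v - a + (a + (N : ℤ) • t) = v + (N : ℤ) • t := by abel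
      simp only [hg, hv, Pfun, cosetSecond_add_zsmul]
      ring
    rw [e2, tsum_mul_left, ← tsum_coset_eq_tsum_shift hN a g]
    congr 1
    have e3 := (hasSum_left_collapse (N := N) h0 h1 hh a v κ l (cosetSecond N h v κ l)).tsum_eq
    rw [left_collapse_value] at e3
    rw [← e3]
    exact tsum_congr fun u => by ring
  · exact fun t => hS'.prod_factor t
  · exact fun v => hS'.prod_symm.prod_factor v

end Pair

section PairSum

variable {h : (Fin d → ℤ) → ℝ} {B : (Fin d → ℤ) → (Fin d → ℤ) → ℝ} {σ : ℝ} {C : Fin d → ℝ}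

/-- [folklore] **Steps (E)–(H) assembled.**  The pair series `Σ'_{(u,u′)} h u · B u u′ · P u′` equals
`σ² · Σ_r Σ'_v (v − resSite r)_κ (v − resSite r)_λ · B (resSite r) v` — the `Q(a)` and `C C` terms die by (T0) at the second
vertex, the `Q(v)` term by periodicity of `Q` and (T0) at the first vertex (`sum_residue_tsum_mul_periodic_eq_zero`). -/
theorem pair_tsum_eq (hN : 0 < N) (h0 : ConstReproSum N h σ) (h1 : LinReproSum N h C) (hh : AbsMoment₂ h)
    (hper : ∀ u x t, B (u + (N : ℤ) • t) (x + (N : ℤ) • t) = B u x)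
    (hT0a : ∀ a, HasSum (fun x => B a x) 0) (hT0b : ∀ x, HasSum (fun a => B a x) 0) (κ l : Fin d)
    (hBm2 : ∀ a, Summable fun v : Fin d → ℤ => B a v * ((((v - a) κ : ℤ) : ℝ) * (((v - a) l : ℤ) : ℝ)))
    (hS2 : Summable fun p : (Fin d → ℤ) × (Fin d → ℤ) => h p.1 * B p.1 p.2 * Pfun N h σ C κ l p.2) :
    ∑' p : (Fin d → ℤ) × (Fin d → ℤ), h p.1 * B p.1 p.2 * Pfun N h σ C κ l p.2
      = σ ^ 2 * ∑ r : Fin d → Fin N, ∑' v : Fin d → ℤ,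
          B (resSite r) v * ((((v - resSite r) κ : ℤ) : ℝ) * (((v - resSite r) l : ℤ) : ℝ)) := by
  -- `Σ'_{(u,u′)} = Σ'_u Σ'_{u′}` and split `u` into residue classes
  rw [hS2.tsum_prod, tsum_eq_sum_residue hN hS2.prod]
  -- per class: steps (E)–(G)
  have hcls : ∀ r : Fin d → Fin N,
      ∑' t : Fin d → ℤ, ∑' u', h (resSite r + (N : ℤ) • t) * B (resSite r + (N : ℤ) • t) u' * Pfun N h σ C κ l u'
        = σ ^ 2 * ∑' v, B (resSite r) v * ((((v - resSite r) κ : ℤ) : ℝ) * (((v - resSite r) l : ℤ) : ℝ))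
          + (σ * cosetSecond N h (resSite r) κ l - 2 * (C κ * C l)) * ∑' v, B (resSite r) v
          + σ * ∑' v, B (resSite r) v * cosetSecond N h v κ l := by
    intro r
    -- summability of the shifted class family from `hS2` along the injection `(t,u′) ↦ (resSite r + N•t, u′ + N•t)`
    have hinj : Function.Injective fun p : (Fin d → ℤ) × (Fin d → ℤ) =>
        (resSite r + (N : ℤ) • p.1, p.2 + (N : ℤ) • p.1) := by
      have hN' : (N : ℤ) ≠ 0 := by exact_mod_cast hN.ne'
      intro p q hpq
      simp only [Prod.mk.injEq] at hpq
      obtain ⟨h1', h2'⟩ := hpq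
      have ht : p.1 = q.1 := by
        have := add_left_cancel h1'
        funext i
        have hi := congrFun this i
        simp only [Pi.smul_apply, smul_eq_mul] at hi
        exact mul_left_cancel₀ hN' hi
      refine Prod.ext ht ?_
      rw [ht] at h2'
      exact add_right_cancel h2'
    have hS := hS2.comp_injective hinj
    rw [residue_class_pair_tsum hN h0 h1 hh hper κ l r hS]
    -- split the three summable pieces
    obtain ⟨M, hM⟩ := exists_bound_of_periodic hN (Q := fun v => cosetSecond N h v κ l)
      (fun v t => cosetSecond_add_zsmul N h v t κ l)
    have s1 := hBm2 (resSite r)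
    have s2 := (hT0a (resSite r)).summable
    have s3 := summable_mul_of_bounded s2 hM
    have e : ∀ v, B (resSite r) v *
        (σ ^ 2 * ((((v - resSite r) κ : ℤ) : ℝ) * (((v - resSite r) l : ℤ) : ℝ)) + σ * cosetSecond N h (resSite r) κ l
          + σ * cosetSecond N h v κ l - 2 * (C κ * C l))
        = σ ^ 2 * (B (resSite r) v * ((((v - resSite r) κ : ℤ) : ℝ) * (((v - resSite r) l : ℤ) : ℝ)))
          + (σ * cosetSecond N h (resSite r) κ l - 2 * (C κ * C l)) * B (resSite r) v
          + σ * (B (resSite r) v * cosetSecond N h v κ l) := fun v => by ring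
    simp_rw [e]
    rw [((s1.mul_left _).add (s2.mul_left _)).tsum_add (s3.mul_left _), (s1.mul_left _).tsum_add (s2.mul_left _),
      tsum_mul_left, tsum_mul_left, tsum_mul_left]
  simp_rw [hcls]
  -- sum over classes: the middle terms vanish ((T0) second vertex), the last by step (H)
  have hz2 : ∀ r : Fin d → Fin N, ∑' v, B (resSite r) v = 0 := fun r => (hT0a (resSite r)).tsum_eq
  simp_rw [hz2, mul_zero, add_zero]
  rw [Finset.sum_add_distrib, ← Finset.mul_sum, ← Finset.mul_sum,
    sum_residue_tsum_mul_periodic_eq_zero hN hper hT0b (fun a => (hT0a a).summable)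
      (Q := fun v => cosetSecond N h v κ l) (fun v t => cosetSecond_add_zsmul N h v t κ l), mul_zero, add_zero]

end PairSum

/-! ## §7 The assembly: decimated second moment of the dressed periodic kernel -/

section Main

variable {h : (Fin d → ℤ) → ℝ} {B : (Fin d → ℤ) → (Fin d → ℤ) → ℝ} {σ : ℝ} {C : Fin d → ℝ}

/-- [our object] **The dressed kernel** of the pair `(h, B)`: `𝒦 y := Σ'_{(u,x)} h u · B u (x + y) · h x` (the bubble/tadpole part of the
coarse one-loop kernel at coarse offset `z` is `𝒦 (N•z)`, REP-DESIGN ALG-1). -/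
def dressedK (h : (Fin d → ℤ) → ℝ) (B : (Fin d → ℤ) → (Fin d → ℤ) → ℝ) (y : Fin d → ℤ) : ℝ :=
  ∑' p : (Fin d → ℤ) × (Fin d → ℤ), h p.1 * B p.1 (p.2 + y) * h p.2

/-- [our object] The windowed second-moment weight `W y := cosetInd N y · y_κ y_λ` (as a real number). -/
def Wgt (N : ℕ) (κ l : Fin d) (y : Fin d → ℤ) : ℝ := ((cosetInd N y * (y κ * y l) : ℤ) : ℝ)

/-- [folklore] (E1) in `tsum` form with the weight `Wgt`: `Σ'_x Wgt (b − x) · h x = Pfun … b`. -/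
theorem tsum_Wgt_mul_eq_Pfun (h0 : ConstReproSum N h σ) (h1 : LinReproSum N h C) (hh : AbsMoment₂ h) (κ l : Fin d)
    (b : Fin d → ℤ) : ∑' x, Wgt N κ l (b - x) * h x = Pfun N h σ C κ l b := by
  have e := (hasSum_right_collapse (N := N) h0 h1 hh b κ l).tsum_eq
  unfold Pfun
  rw [← e]
  exact tsum_congr fun x => by rw [Wgt, zsmul_eq_mul]

/-- [folklore] **ALG-2 — THE PERIODIC TRANSPORT IDENTITY.**  `h` reproduces constants (`σ`) and linear data (`C`) through `N•ℤ^d`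
and has absolutely summable second moments; `B` is jointly `N`-periodic with (T0) at both vertices; the triple family
`((u,u′),x) ↦ h u · B u u′ · Wgt (u′ − x) · h x` is summable and the base-point second moments of `B` converge absolutely.  Then the
`N•ℤ^d`-decimated second moment of the dressed kernel IS `σ²` times the base-point SUM of the fine second moments:
`Σ_z (N z)_κ (N z)_λ · 𝒦 (N•z) = σ² · Σ_r Σ'_v B (resSite r) v · (v − resSite r)_κ (v − resSite r)_λ`. -/
theorem periodicTransport_hasSum (hN : 0 < N) (h0 : ConstReproSum N h σ) (h1 : LinReproSum N h C) (hh : AbsMoment₂ h)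
    (hper : ∀ u x t, B (u + (N : ℤ) • t) (x + (N : ℤ) • t) = B u x)
    (hT0a : ∀ a, HasSum (fun x => B a x) 0) (hT0b : ∀ x, HasSum (fun a => B a x) 0) (κ l : Fin d)
    (hBm2 : ∀ a, Summable fun v : Fin d → ℤ => B a v * ((((v - a) κ : ℤ) : ℝ) * (((v - a) l : ℤ) : ℝ)))
    (hS3 : Summable fun q : ((Fin d → ℤ) × (Fin d → ℤ)) × (Fin d → ℤ) =>
      h q.1.1 * B q.1.1 q.1.2 * (Wgt N κ l (q.1.2 - q.2) * h q.2)) :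
    HasSum (fun z : Fin d → ℤ => ((((N : ℤ) • z) κ * ((N : ℤ) • z) l : ℤ)) • dressedK h B ((N : ℤ) • z))
      (σ ^ 2 * ∑ r : Fin d → Fin N, ∑' v : Fin d → ℤ,
          B (resSite r) v * ((((v - resSite r) κ : ℤ) : ℝ) * (((v - resSite r) l : ℤ) : ℝ))) := by
  -- the triple family and its total
  set F3' : ((Fin d → ℤ) × (Fin d → ℤ)) × (Fin d → ℤ) → ℝ :=
    fun q => h q.1.1 * B q.1.1 q.1.2 * (Wgt N κ l (q.1.2 - q.2) * h q.2) with hF3'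
  -- (i) fibre sums over `x`: the pair family `h u · B u u′ · P u′`
  have hfib : ∀ p : (Fin d → ℤ) × (Fin d → ℤ), ∑' x, F3' (p, x) = h p.1 * B p.1 p.2 * Pfun N h σ C κ l p.2 := by
    intro p
    simp only [hF3']
    rw [tsum_mul_left, tsum_Wgt_mul_eq_Pfun h0 h1 hh]
  have hS2 : Summable fun p : (Fin d → ℤ) × (Fin d → ℤ) => h p.1 * B p.1 p.2 * Pfun N h σ C κ l p.2 :=
    (hS3.prod).congr hfib
  have htot : ∑' q, F3' q = σ ^ 2 * ∑ r : Fin d → Fin N, ∑' v : Fin d → ℤ,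
      B (resSite r) v * ((((v - resSite r) κ : ℤ) : ℝ) * (((v - resSite r) l : ℤ) : ℝ)) := by
    rw [hS3.tsum_prod, tsum_congr hfib]
    exact pair_tsum_eq hN h0 h1 hh hper hT0a hT0b κ l hBm2 hS2
  -- (iii) reindex to `(y, (u, x))` with `u′ = x + y`
  let e3 : (Fin d → ℤ) × ((Fin d → ℤ) × (Fin d → ℤ)) ≃ ((Fin d → ℤ) × (Fin d → ℤ)) × (Fin d → ℤ) :=
    { toFun := fun q => ((q.2.1, q.2.2 + q.1), q.2.2)
      invFun := fun q => (q.1.2 - q.2, (q.1.1, q.2))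
      left_inv := fun q => by simp
      right_inv := fun q => by simp }
  have hF3 : HasSum (fun q : (Fin d → ℤ) × ((Fin d → ℤ) × (Fin d → ℤ)) => F3' (e3 q)) (∑' q, F3' q) :=
    (e3.hasSum_iff (f := F3')).2 hS3.hasSum
  -- (iv) fibre sums over `(u, x)`: `Wgt y · 𝒦 y`
  have hfib2 : ∀ y : Fin d → ℤ, HasSum (fun ux : (Fin d → ℤ) × (Fin d → ℤ) => F3' (e3 (y, ux)))
      (Wgt N κ l y * dressedK h B y) := by
    intro y
    have hsy : Summable fun ux : (Fin d → ℤ) × (Fin d → ℤ) => F3' (e3 (y, ux)) :=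
      ((e3.summable_iff (f := F3')).2 hS3).prod_factor y
    have := hsy.hasSum
    rw [show (∑' ux : (Fin d → ℤ) × (Fin d → ℤ), F3' (e3 (y, ux))) = Wgt N κ l y * dressedK h B y from ?_] at this
    · exact this
    unfold dressedK
    rw [← tsum_mul_left]
    refine tsum_congr fun ux => ?_
    simp only [hF3', e3, Equiv.coe_fn_mk]
    ring
  have hwin : HasSum (fun y : Fin d → ℤ => Wgt N κ l y * dressedK h B y) (∑' q, F3' q) := hF3.prod_fiberwise hfib2
  rw [htot] at hwin
  -- (v) decimation: the window `cosetInd N` restricts `y` to `N•z`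
  have hN' : N ≠ 0 := hN.ne'
  refine (DecimatedMomentLimit.hasSum_decimate_iff hN' (fun y => y κ * y l) (dressedK h B) _).2 ?_
  refine hwin.congr_fun fun y => ?_
  rw [Wgt, zsmul_eq_mul]

end Main

end Summit.QuantumFields.BalabanUV.Beta.FP.PeriodicTransportMain

end
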